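import Summits.NavierStokesRegularity.NavierStokesRegularity.Theorems.SoloSalvageWu2026ConstructPieceEGradient
import HarnessLib

/-!
# C177 `Wu2026` — toward `Step_construct` (E), Sobolev bounds (3.35): the uniform `W^{1,9/5}` and
# `L^{9/2}` bounds of `χ_N V_j` at good scales (the interface for the weak-limit step)

Seat `ns-in-wu-341` on sub-binder (E) of `step_construct_of_pieces` (cut owner `ns-inputs-plan` g5,
08:24Z). Salvage conventions: theorems only, standard axioms, no definition, no named fact;
`--supports` item 0897.

Print (arXiv:2608.22471v1, p.13 l.26–40, (3.34)–(3.35)): «‖∇V_j‖_{L^{9/5}(G)} ≤ C_{G,G′}(‖curl V_j‖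
+ ‖V_j‖) ≤ C_{G,G′} (3.34) … the sequence is therefore bounded in the reflexive space W^{1,9/5}(G) …
The Sobolev embedding W^{1,9/5}(G) ↪ L^{9/2}(G)».

* `pieceE_uniform_bounds` — for an `IsWuFlow` with the annular bound (3.18) and good scales
  `n` (`a_{n_j+m} ≤ B_m`, `j ≥ max{1,m}`), and every `N`: the shell cut-off `χ_N` of
  `exists_shellCutoff` (`= 1` on `{1 + 1/(N+3) ≤ |y| ≤ 2^{N+1} − 1/3}`, supported in
  `{1 < |y| < 2^{N+1}}`) and a finite `M_N` with
  `‖D(χ_N V_j)‖_{L^{9/5}(ℝ³)} ≤ M_N` and `‖χ_N V_j‖_{L^{9/2}(ℝ³)} ≤ M_N` for all `j ≥ max{1, N}`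
  (`V_j = blowDown 2^{n_j} v`): (3.32)–(3.33) on the shell (`…ConstructPieceEScaling`), the Leibniz
  bounds (`…ConstructPieceEGradient`), the TREE's div–curl estimate
  `exists_eLpNorm_fderiv_le_curl_add_divergence`, and Mathlib's Gagliardo–Nirenberg–Sobolev
  inequality `eLpNorm_le_eLpNorm_fderiv_of_eq` (`p = 9/5`, `p* = 9/2`, `n = 3`).

This is the E-low/E-high interface: the weak `L^{9/5}` limit of `D(χ_N V_j)` (a weak gradient of
`V` on `{χ_N = 1}`) and the gluing over `N` produce hypothesis (E).

WHAT THIS IS NOT: not a proof of `Step_construct`; not a claim about NS regularity or blow-up; not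
a claim about any author beyond the typed locator.
-/

noncomputable section

set_option linter.dupNamespace false

open MeasureTheory Set Function Filter Topology Metric
open scoped ENNReal NNReal RealInnerProductSpace ContDiff

namespace Summit.NavierStokesRegularity.NavierStokesRegularity.Theorems.Wu2026Salvage

open Literature.Claims.NS.Wu2026 Literature.Analysis.FluidPDE Literature.Analysis.FunctionSpaces

/-- `‖1_S f‖_{9/5} ≤ (∫_{T} |f|^{9/5})^{5/9}`-type bound: for `S ⊆ T`,
`eLpNorm (S.indicator f) (9/5) ≤ (∫⁻_T ‖f‖ₑ^{9/5})^{5/9}`. [folklore] -/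
theorem eLpNorm_indicator_nine_fifths_le {F : Type*} [NormedAddCommGroup F] {f : E3 → F}
    {S T : Set E3} (hST : S ⊆ T) (hT : MeasurableSet T) :
    eLpNorm (S.indicator f) ((9 : ℝ≥0∞) / 5) volume ≤
      (∫⁻ y in T, ‖f y‖ₑ ^ ((9 : ℝ) / 5)) ^ ((5 : ℝ) / 9) := by
  have h95 : ((9 : ℝ≥0∞) / 5).toReal = 9 / 5 := by rw [ENNReal.toReal_div]; norm_num
  have h0 : ((9 : ℝ≥0∞) / 5) ≠ 0 := by norm_num
  have ht : ((9 : ℝ≥0∞) / 5) ≠ ⊤ := ENNReal.div_ne_top (by norm_num) (by norm_num)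
  calc eLpNorm (S.indicator f) ((9 : ℝ≥0∞) / 5) volume
      ≤ eLpNorm (T.indicator f) ((9 : ℝ≥0∞) / 5) volume :=
        eLpNorm_mono fun y => norm_indicator_le_of_subset hST f y
    _ = (∫⁻ y in T, ‖f y‖ₑ ^ ((9 : ℝ) / 5)) ^ ((5 : ℝ) / 9) := by
        rw [eLpNorm_indicator_eq_eLpNorm_restrict hT, eLpNorm_eq_lintegral_rpow_enorm_toReal h0 ht, h95]
        norm_num

/-- **The uniform bounds at good scales (interface for the weak-limit step).** See the module
docstring. [cite: Wu2026, (3.32)–(3.35) p.13 l.1–40] -/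
theorem pieceE_uniform_bounds {ν : ℝ} {v : E3 → E3} {p : E3 → ℝ} (hf : IsWuFlow ν v p)
    (h318 : ∀ q : ℝ, 1 < q → q < 9 / 2 → ∃ C : ℝ, ∀ R : ℝ, 0 < R →
      IntegrableOn (fun x => ‖v x‖ ^ q) (annulus R) ∧
      (∫ x in annulus R, ‖v x‖ ^ q) ^ (1 / q) ≤ C * R ^ (-(2 : ℝ) / 3 + 3 / q))
    {n : ℕ → ℕ} (hgood : ∀ m : ℕ, ∃ B : ℝ, ∀ j : ℕ, max 1 m ≤ j → dyMass v (n j + m) ≤ B)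
    (N : ℕ) :
    ∃ χ : E3 → ℝ, ContDiff ℝ ∞ χ ∧ HasCompactSupport χ ∧ (∀ y, 0 ≤ χ y ∧ χ y ≤ 1) ∧
      (∀ y, 1 + 1 / ((N : ℝ) + 3) ≤ ‖y‖ → ‖y‖ ≤ (2 : ℝ) ^ (N + 1) - 1 / 3 → χ y = 1) ∧
      tsupport χ ⊆ {y : E3 | 1 < ‖y‖ ∧ ‖y‖ < (2 : ℝ) ^ (N + 1)} ∧
      ∃ M : ℝ≥0∞, M < ⊤ ∧ ∀ j : ℕ, max 1 N ≤ j →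
        eLpNorm (fderiv ℝ (fun y => χ y • blowDown ((2 : ℝ) ^ n j) v y)) ((9 : ℝ≥0∞) / 5) volume
            ≤ M ∧
        eLpNorm (fun y => χ y • blowDown ((2 : ℝ) ^ n j) v y) ((9 : ℝ≥0∞) / 2) volume ≤ M := by
  -- exponents
  have h95_1 : (1 : ℝ≥0∞) < 9 / 5 := by
    rw [ENNReal.lt_div_iff_mul_lt (Or.inl (by norm_num)) (Or.inl (by norm_num))]; norm_num
  have h95_t : ((9 : ℝ≥0∞) / 5) < ⊤ := ENNReal.div_lt_top (by norm_num) (by norm_num)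
  have hcoe95 : (((9 / 5 : ℝ≥0)) : ℝ≥0∞) = (9 : ℝ≥0∞) / 5 := by
    rw [ENNReal.coe_div (by norm_num)]; norm_num
  have hcoe92 : (((9 / 2 : ℝ≥0)) : ℝ≥0∞) = (9 : ℝ≥0∞) / 2 := by
    rw [ENNReal.coe_div (by norm_num)]; norm_num
  -- the cut-off
  obtain ⟨χ, hχs, hχc, hχ01, hχ1, hχS, L, hL0, hL⟩ := exists_shellCutoff N
  set Lnn : ℝ≥0 := ⟨L, hL0⟩ with hLnn
  have hL' : ∀ y, ‖fderiv ℝ χ y‖ ≤ (Lnn : ℝ) := fun y => hL y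
  have hshell : MeasurableSet {y : E3 | 1 < ‖y‖ ∧ ‖y‖ < (2 : ℝ) ^ (N + 1)} :=
    (isOpen_lt continuous_const continuous_norm).inter (isOpen_lt continuous_norm continuous_const)
      |>.measurableSet
  -- the shell bounds (3.32), (3.33)
  have hv1 : ContDiff ℝ 1 v := hf.smooth_v.of_le (by exact_mod_cast le_top)
  obtain ⟨Bc, hBc⟩ := exists_lintegral_shell_curl_blowDown_le hv1 hgood N
  obtain ⟨Bv, hBv⟩ := exists_lintegral_shell_blowDown_le hf.smooth_v.continuous
    (h318 ((9 : ℝ) / 5) (by norm_num) (by norm_num)) N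
  -- the two Calderón–Zygmund / Sobolev constants
  obtain ⟨Cdc, hCdc⟩ := exists_eLpNorm_fderiv_le_curl_add_divergence h95_1 h95_t
  set Dv : ℝ≥0∞ := (ENNReal.ofReal Bv) ^ ((5 : ℝ) / 9) with hDv
  set Dc : ℝ≥0∞ := (ENNReal.ofReal Bc) ^ ((5 : ℝ) / 9) with hDc
  set M₁ : ℝ≥0∞ := (Cdc : ℝ≥0∞) * ((Dc + (‖curlCLM‖₊ * Lnn) • Dv) + Lnn • Dv) with hM₁
  set M₂ : ℝ≥0∞ := (SNormLESNormFDerivOfEqConst E3 (volume : Measure E3) ((9 / 5 : ℝ≥0) : ℝ) : ℝ≥0∞) * M₁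
    with hM₂
  have hDvt : Dv < ⊤ := ENNReal.rpow_lt_top_of_nonneg (by norm_num) ENNReal.ofReal_ne_top
  have hDct : Dc < ⊤ := ENNReal.rpow_lt_top_of_nonneg (by norm_num) ENNReal.ofReal_ne_top
  have hM₁t : M₁ < ⊤ := by
    refine ENNReal.mul_lt_top ENNReal.coe_lt_top (ENNReal.add_lt_top.2 ⟨ENNReal.add_lt_top.2
      ⟨hDct, ?_⟩, ?_⟩)
    · rw [ENNReal.smul_def, smul_eq_mul]; exact ENNReal.mul_lt_top ENNReal.coe_lt_top hDvt
    · rw [ENNReal.smul_def, smul_eq_mul]; exact ENNReal.mul_lt_top ENNReal.coe_lt_top hDvt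
  have hM₂t : M₂ < ⊤ := ENNReal.mul_lt_top ENNReal.coe_lt_top hM₁t
  refine ⟨χ, hχs, hχc, hχ01, hχ1, hχS, max M₁ M₂, max_lt hM₁t hM₂t, fun j hj => ?_⟩
  -- the blow-down at scale `R_j`
  have hR : (0 : ℝ) < (2 : ℝ) ^ n j := pow_pos two_pos _
  set V : E3 → E3 := blowDown ((2 : ℝ) ^ n j) v with hV
  have hVs : ContDiff ℝ ∞ V := contDiff_blowDown hf.smooth_v _
  have hV1 : ContDiff ℝ 1 V := hVs.of_le (by exact_mod_cast le_top)
  have hVdiv : VectorCalculus.IsDivFree V := (isLerayProfile_blowDown hf.profile hR).divFree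
  set W : E3 → E3 := fun y => χ y • V y with hW
  have hWs : ContDiff ℝ ∞ W := hχs.smul hVs
  have hWc : HasCompactSupport W := hχc.smul_right
  have hχ1' : ContDiff ℝ 1 χ := hχs.of_le (by exact_mod_cast le_top)
  -- the indicator norms on the shell
  have hIV : eLpNorm ((tsupport χ).indicator V) ((9 : ℝ≥0∞) / 5) volume ≤ Dv :=
    (eLpNorm_indicator_nine_fifths_le hχS hshell).trans
      (ENNReal.rpow_le_rpow (hBv _ hR) (by norm_num))
  have hIC : eLpNorm ((tsupport χ).indicator (curl V)) ((9 : ℝ≥0∞) / 5) volume ≤ Dc :=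
    (eLpNorm_indicator_nine_fifths_le hχS hshell).trans
      (ENNReal.rpow_le_rpow (hBc j hj) (by norm_num))
  -- div and curl of `W`
  have hdivW : eLpNorm (VectorCalculus.divergence W) ((9 : ℝ≥0∞) / 5) volume ≤ Lnn • Dv :=
    (eLpNorm_divergence_cutoff_smul_le hV1 hVdiv hχ1' hL' _).trans (by
      rw [ENNReal.smul_def, ENNReal.smul_def, smul_eq_mul, smul_eq_mul]
      exact mul_le_mul' le_rfl hIV)
  have hcurlW : eLpNorm (curl W) ((9 : ℝ≥0∞) / 5) volume ≤ Dc + (‖curlCLM‖₊ * Lnn) • Dv :=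
    (eLpNorm_curl_cutoff_smul_le hV1 hχ1' hχ01 hL' h95_1.le).trans (by
      refine add_le_add hIC ?_
      rw [ENNReal.smul_def, ENNReal.smul_def, smul_eq_mul, smul_eq_mul]
      exact mul_le_mul' le_rfl hIV)
  -- (3.34): the gradient
  have hgrad : eLpNorm (fderiv ℝ W) ((9 : ℝ≥0∞) / 5) volume ≤ M₁ :=
    (hCdc W hWs hWc).trans (mul_le_mul' le_rfl (add_le_add hcurlW hdivW))
  -- Sobolev: `‖W‖_{9/2} ≤ C ‖DW‖_{9/5}`
  have hsob : eLpNorm W ((9 : ℝ≥0∞) / 2) volume ≤ M₂ := by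
    have hW1 : ContDiff ℝ 1 W := hWs.of_le (by exact_mod_cast le_top)
    have h := eLpNorm_le_eLpNorm_fderiv_of_eq (μ := (volume : Measure E3)) hW1 hWc
      (p := (9 / 5 : ℝ≥0)) (p' := (9 / 2 : ℝ≥0))
      (by rw [← NNReal.coe_le_coe]; push_cast; norm_num)
      (by rw [finrank_euclideanSpace, Fintype.card_fin]; norm_num)
      (by rw [finrank_euclideanSpace, Fintype.card_fin]; push_cast; norm_num)
    rw [hcoe95, hcoe92] at h
    exact h.trans (mul_le_mul' le_rfl hgrad)
  exact ⟨hgrad.trans (le_max_left _ _), hsob.trans (le_max_right _ _)⟩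

end Summit.NavierStokesRegularity.NavierStokesRegularity.Theorems.Wu2026Salvage

end

-- WHAT THIS IS NOT: not a claim about NS regularity or blow-up; not a claim about any author beyond the typed locator.
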